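import Summits.Ventures.LatticeQCDFlow.Scoring.MadrasSokalDataWindow

/-!
# The TANGENTIAL crossing: when `c τ_w = w` exactly, the data-chosen Madras–Sokal window does NOT settle — `P(Ŵ_N = w) → ½`

HONEST FRAMING: exact (Metropolis-corrected) sampling algorithms for lattice gauge theory;
figures of merit are autocorrelation/cost numbers at stated couplings and volumes; no
continuum-physics claim.

Venture `LatticeQCDFlow` (cell pub-lqcd), sub-topic `Scoring`; FANOUT row 16 (`su2-base`), GEN-8.
NEW WORK of the cell over GEN-8's `Scoring/MadrasSokalDataWindow` (strict crossings: `P(Ŵ_N ≠ w) → 0`)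
and Mathlib's portmanteau theorem / Gaussian symmetry; no definition; nothing cited as a fact.

`MadrasSokalDataWindow` lists the tangential case as NOT CLAIMED.  THIS FILE settles what happens
there.  Suppose the population curve satisfies the Madras–Sokal inequalities STRICTLY below `w`
(`W' < c τ_{W'}` for `1 ≤ W' < w`, as in `IsMSWindow`) but EXACTLY at `w`: `c τ_w = w`.  If the windowed
estimates are consistent below `w` and `√N (τ̂_N(w) − τ_w) ⇒ Y` with `Y ~ N(0, v)`, `v > 0`, then

* `gaussianReal_Iic_zero` — `N(0, v)((−∞, 0]) = ½` (`v > 0`; reflection symmetry, no atom at `0`);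
* `tendsto_measure_le_of_clt` — `P(τ̂_N(w) ≤ τ_w) → ½` (portmanteau on the half-line, null frontier);
* **`tendsto_measure_isMSWindow_tangential`** — `P(w is the MS window of τ̂_N(·)) → ½`: the empirical
  window picks `w` or a later window with asymptotically equal odds, so at a tangential `(curve, c)` the
  fixed-window limit laws do NOT transfer through `Ŵ_N` (the limit is a genuine mixture) — the reason
  `MadrasSokalDataWindow` requires a strict crossing, and why that hypothesis is not cosmetic.

NOT CLAIMED: the mixture law itself; which later window is picked; numbers.
-/

noncomputable section

open MeasureTheory ProbabilityTheory Filter Set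
open scoped Topology ENNReal NNReal

namespace Summit.Ventures.LatticeQCDFlow.Scoring

/-! ## §1 `N(0, v)((−∞, 0]) = ½` -/

section Gaussian

/-- A centred Gaussian with positive variance gives mass `½` to `(−∞, 0]` (general `v`, in `ℝ≥0∞`;
the unit-variance `Measure.real` form is row 36's `AgreementTestLocalPower.gaussianReal_real_Iic_zero`,
not imported: different normalisation, and that module has no olean at the time of writing). -/
theorem gaussianReal_Iic_zero {v : ℝ≥0} (hv : v ≠ 0) : gaussianReal 0 v (Iic (0 : ℝ)) = 1 / 2 := by
  haveI := nullSingletonClass_gaussianReal (μ := 0) hv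
  -- reflection symmetry: `μ(Iic 0) = μ(Ici 0)`
  have hsymm : gaussianReal 0 v (Iic (0 : ℝ)) = gaussianReal 0 v (Ici (0 : ℝ)) := by
    have h := gaussianReal_map_neg (μ := 0) (v := v)
    rw [neg_zero] at h
    calc gaussianReal 0 v (Iic (0 : ℝ))
        = ((gaussianReal 0 v).map fun x : ℝ => -x) (Iic (0 : ℝ)) := by rw [h]
      _ = gaussianReal 0 v ((fun x : ℝ => -x) ⁻¹' Iic (0 : ℝ)) :=
          Measure.map_apply (by fun_prop) measurableSet_Iic
      _ = gaussianReal 0 v (Ici (0 : ℝ)) := by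
          congr 1; ext x; simp only [mem_preimage, mem_Iic, mem_Ici, neg_nonpos]
  -- no atom at `0`: `μ(Ici 0) = μ(Ioi 0)`; and `μ(Iic 0) + μ(Ioi 0) = 1`
  have h0 : gaussianReal 0 v {(0 : ℝ)} = 0 := measure_singleton 0
  have hIci : gaussianReal 0 v (Ici (0 : ℝ)) = gaussianReal 0 v (Ioi (0 : ℝ)) := by
    refine le_antisymm ?_ (measure_mono Ioi_subset_Ici_self)
    calc gaussianReal 0 v (Ici (0 : ℝ)) = gaussianReal 0 v (Ioi 0 ∪ {0}) := by
          rw [Ioi_union_left]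
      _ ≤ gaussianReal 0 v (Ioi 0) + gaussianReal 0 v {0} := measure_union_le _ _
      _ = gaussianReal 0 v (Ioi 0) := by rw [h0, add_zero]
  have hsum : gaussianReal 0 v (Iic (0 : ℝ)) + gaussianReal 0 v (Ioi (0 : ℝ)) = 1 := by
    rw [← measure_union (Iic_disjoint_Ioi le_rfl) measurableSet_Ioi, Iic_union_Ioi, measure_univ]
  have h2 : 2 * gaussianReal 0 v (Iic (0 : ℝ)) = 1 := by rw [two_mul]; nth_rw 2 [hsymm]; rw [hIci, hsum]
  rw [ENNReal.eq_div_iff two_ne_zero ENNReal.ofNat_ne_top]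
  exact h2

end Gaussian

/-! ## §2 A `√N`-CLT at the centring point splits the half-lines evenly -/

section HalfLine

variable {Ω : Type*} [MeasurableSpace Ω] {P : Measure Ω} [IsProbabilityMeasure P]
variable {Ω' : Type*} [MeasurableSpace Ω'] {P' : Measure Ω'} [IsProbabilityMeasure P']

/-- **`P(T_N ≤ θ) → ½`** whenever `√N (T_N − θ) ⇒ N(0, v)` with `v > 0` (portmanteau on `(−∞, 0]`,
whose frontier `{0}` is Gaussian-null). -/
theorem tendsto_measure_le_of_clt {T : ℕ → Ω → ℝ} {θ : ℝ} {Y : Ω' → ℝ} {v : ℝ≥0} (hv : v ≠ 0)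
    (hY : HasLaw Y (gaussianReal 0 v) P')
    (hclt : TendstoInDistribution (fun (N : ℕ) ω => Real.sqrt N * (T N ω - θ)) atTop Y (fun _ => P) P') :
    Tendsto (fun N : ℕ => P {ω | T N ω ≤ θ}) atTop (𝓝 (1 / 2)) := by
  haveI := nullSingletonClass_gaussianReal (μ := 0) hv
  have hnull : (P'.map Y) (frontier (Iic (0 : ℝ))) = 0 := by
    rw [hY.map_eq, frontier_Iic]
    exact measure_singleton 0
  have key := ProbabilityMeasure.tendsto_measure_of_null_frontier_of_tendsto' hclt.tendsto
    (E := Iic (0 : ℝ)) (by simpa using hnull)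
  simp only [ProbabilityMeasure.coe_mk] at key
  rw [hY.map_eq, gaussianReal_Iic_zero hv] at key
  refine (key.congr' ?_)
  filter_upwards [eventually_gt_atTop 0] with N hN
  rw [Measure.map_apply_of_aemeasurable (hclt.forall_aemeasurable N) measurableSet_Iic]
  congr 1
  ext ω
  have hs : 0 < Real.sqrt N := Real.sqrt_pos.2 (Nat.cast_pos.2 hN)
  simp only [mem_preimage, mem_Iic, mem_setOf_eq]
  constructor
  · intro h
    have : T N ω - θ ≤ 0 := by
      by_contra hlt; push Not at hlt
      exact absurd h (not_le.2 (mul_pos hs hlt))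
    linarith
  · intro h
    exact mul_nonpos_of_nonneg_of_nonpos hs.le (by linarith)

end HalfLine

/-! ## §3 At a tangential crossing the empirical window picks `w` with probability `→ ½` -/

section Tangential

variable {Ω : Type*} [MeasurableSpace Ω] {P : Measure Ω} [IsProbabilityMeasure P]
variable {Ω' : Type*} [MeasurableSpace Ω'] {P' : Measure Ω'} [IsProbabilityMeasure P']

omit [IsProbabilityMeasure P] in
/-- Below a window where the population inequalities fail STRICTLY, consistency makes them fail for the
empirical curve too, with probability `→ 1` (the 'below' half of the margin argument). -/
theorem tendsto_measure_not_below {τhat : ℕ → ℕ → Ω → ℝ} {τW : ℕ → ℝ} {c : ℝ} {w : ℕ} (hc : 0 < c)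
    (hbelow : ∀ W', 1 ≤ W' → W' < w → (W' : ℝ) < c * τW W')
    (hconv : ∀ W, 1 ≤ W → W < w → TendstoInMeasure P (fun N => τhat N W) atTop fun _ => τW W) :
    Tendsto (fun N : ℕ => P {ω | ¬ ∀ W', 1 ≤ W' → W' < w → (W' : ℝ) < c * τhat N W' ω}) atTop (𝓝 0) := by
  by_cases hw : (Finset.Ico 1 w).Nonempty
  · -- margin below `w`
    let g : ℕ → ℝ := fun W => c * τW W - W
    have hgpos : ∀ W ∈ Finset.Ico 1 w, 0 < g W := fun W hW => by
      rcases Finset.mem_Ico.1 hW with ⟨h1, h2⟩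
      simp only [g]; linarith [hbelow W h1 h2]
    have hinf : 0 < (Finset.Ico 1 w).inf' hw g := (Finset.lt_inf'_iff hw).2 hgpos
    set δ : ℝ := (Finset.Ico 1 w).inf' hw g / c with hδ
    have hδpos : 0 < δ := div_pos hinf hc
    have hsub : ∀ N, {ω | ¬ ∀ W', 1 ≤ W' → W' < w → (W' : ℝ) < c * τhat N W' ω}
        ⊆ ⋃ W ∈ Finset.Ico 1 w, {ω | δ ≤ dist (τhat N W ω) (τW W)} := by
      intro N ω hω
      by_contra hno
      simp only [Set.mem_iUnion, Set.mem_setOf_eq, not_exists, not_le, exists_prop, not_and] at hno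
      refine hω fun W' h1 h2 => ?_
      have hW' : W' ∈ Finset.Ico 1 w := Finset.mem_Ico.2 ⟨h1, h2⟩
      have hd : |τhat N W' ω - τW W'| < δ := by rw [← Real.dist_eq]; exact hno W' hW'
      have hcδ : c * δ ≤ g W' := by rw [hδ, mul_div_cancel₀ _ hc.ne']; exact Finset.inf'_le g hW'
      have hdev : |c * τhat N W' ω - c * τW W'| < g W' := by
        rw [← mul_sub, abs_mul, abs_of_pos hc]
        exact (mul_lt_mul_of_pos_left hd hc).trans_le hcδ
      simp only [g] at hdev
      linarith [(abs_lt.1 hdev).1]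
    have h0 : Tendsto (fun N => ∑ W ∈ Finset.Ico 1 w, P {ω | δ ≤ dist (τhat N W ω) (τW W)})
        atTop (𝓝 0) := by
      have h := tendsto_finsetSum (Finset.Ico 1 w) fun W hW =>
        (tendstoInMeasure_iff_dist.1
          (hconv W (Finset.mem_Ico.1 hW).1 (Finset.mem_Ico.1 hW).2)) δ hδpos
      simpa only [Finset.sum_const_zero] using h
    exact tendsto_of_tendsto_of_tendsto_of_le_of_le tendsto_const_nhds h0 (fun _ => bot_le)
      fun N => (measure_mono (hsub N)).trans (measure_biUnion_finset_le _ _)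
  · -- nothing below `w`
    have hempty : ∀ N, {ω | ¬ ∀ W', 1 ≤ W' → W' < w → (W' : ℝ) < c * τhat N W' ω} = ∅ := by
      intro N
      ext ω
      simp only [Set.mem_setOf_eq, Set.mem_empty_iff_false, iff_false, not_not]
      intro W' h1 h2
      exact absurd ⟨W', Finset.mem_Ico.2 ⟨h1, h2⟩⟩ hw
    simp only [hempty, measure_empty, tendsto_const_nhds]

/-- **AT A TANGENTIAL CROSSING THE WINDOW DOES NOT SETTLE.**  `c > 0`, `1 ≤ w`, the population
Madras–Sokal inequalities fail strictly below `w` and hold with EQUALITY at `w` (`c τ_w = w`); the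
windowed estimates are consistent below `w` and `√N (τ̂_N(w) − τ_w) ⇒ N(0, v)` with `v > 0`.  Then the
probability that `w` IS the Madras–Sokal window of the empirical curve tends to `½`. -/
theorem tendsto_measure_isMSWindow_tangential {τhat : ℕ → ℕ → Ω → ℝ} {τW : ℕ → ℝ} {c : ℝ} {w : ℕ}
    (hc : 0 < c) (hw1 : 1 ≤ w) (htan : c * τW w = w)
    (hbelow : ∀ W', 1 ≤ W' → W' < w → (W' : ℝ) < c * τW W')
    (hconv : ∀ W, 1 ≤ W → W < w → TendstoInMeasure P (fun N => τhat N W) atTop fun _ => τW W)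
    {Y : Ω' → ℝ} {v : ℝ≥0} (hv : v ≠ 0) (hY : HasLaw Y (gaussianReal 0 v) P')
    (hclt : TendstoInDistribution (fun (N : ℕ) ω => Real.sqrt N * (τhat N w ω - τW w)) atTop Y
      (fun _ => P) P') :
    Tendsto (fun N : ℕ => P {ω | IsMSWindow c (fun W => τhat N W ω) w}) atTop (𝓝 (1 / 2)) := by
  have hhalf := tendsto_measure_le_of_clt hv hY hclt
  have hbad := tendsto_measure_not_below (P := P) hc hbelow hconv
  -- the MS-window event and the half-line event agree off the bad event
  refine tendsto_measure_of_eqOn_compl (A := fun N => {ω | τhat N w ω ≤ τW w})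
    (D := fun N => {ω | ¬ ∀ W', 1 ≤ W' → W' < w → (W' : ℝ) < c * τhat N W' ω}) hhalf hbad ?_
  intro N ω hω
  simp only [Set.mem_setOf_eq, not_not] at hω
  simp only [Set.mem_setOf_eq, IsMSWindow]
  have hτw : τW w = w / c := by rw [eq_div_iff hc.ne', mul_comm]; exact htan
  constructor
  · rintro ⟨-, hle, -⟩
    rw [hτw, le_div_iff₀ hc, mul_comm]; exact hle
  · intro hle
    refine ⟨hw1, ?_, hω⟩
    rw [hτw, le_div_iff₀ hc, mul_comm] at hle; exact hle

end Tangential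

end Summit.Ventures.LatticeQCDFlow.Scoring

end
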